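import Summits.CriticalPhenomena.PercolationContinuityZ3.Theorems.Transplant.SkelNegBParamsFoot
import Summits.CriticalPhenomena.PercolationContinuityZ3.Theorems.Transplant.SkelNegBParamsReachTA
import HarnessLib

/-!
# N1 params, chain of record `NegB`, part Foot-A — the (ζ′) twin of part Foot §Values at `A := Aof κ`: the fine extents OF RECORD of a planar box `[±sα] × [±sβ]`
# read by the (ζ′) fine map `fineA` (fields of `prFA`): **`NegB.kFootA₀/kFootA₁ … sα sβ`** with **`hL0_RA/hL1_RA`** (ceilings of hp-8's two inequalities at
# `prFA`'s fields), `kFootA_nonneg`, and the packaged reading **`abs_fineA_le_of_near₂`**; the generic `Skelφ.fine_containment₂` / `…_lam₂` lemmas of part Foot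
# are cell-free and reused.  (stmt-g16 2026-08-22; NEG-SCOPE §B.19 (ζ′).)
builds on p205010 (kernel theorem, internal audit signed; external expert review pending) — nothing in this file uses p205010; NOTHING is claimed about
the node `SamePDropOfSkeletonNeg₁` (OPEN).
Lane `prim-bschramm-*`, seat `prim-bschramm-stmt` (gen 16); helper file (`--supports stmt-CriticalPhenomena-4575 --as helper`); ledger HOME/prim-bschramm-stmt/NEG-PARAMS.md.
[cite: KozmaNitzan2024, §4 Lemma 10 Step IV (p. 21)] [cite: MartineauTassion2017, §4.3 Lemma 4.2]
-/

noncomputable section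

open scoped Classical

namespace Summit.CriticalPhenomena.PercolationContinuityZ3.Theorems.Transplant

namespace PlanarSkeletonNeg

namespace NegB

open Literature.Probability.Percolation Literature.Probability.LatticeModels SimpleGraph
open SkelConc (Consts)
open Skelφ.StepI (DataN)
open TwoAxis.Para (modulus)
open Neg

section Values

variable (κ : Consts) {V : Type} [DecidableEq V] [Countable V] {G : SimpleGraph V} [G.LocallyFinite] (Φ : PlanarSkeletonNeg G) (t : V)
  (p : unitInterval) (D : DataN V) (g f : ℕ) (sα sβ : ℤ)

/-- **The fine extent on axis `0`** of the planar box `[±sα] × [±sβ]`: `kFootA₀ := ⌈c₀·|A|·(|vβ|·sα + |vα|·sβ)/D⌉` (floor + 1). [this work] -/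
def kFootA₀ : ℤ := (prFA κ Φ t p D g f).c₀ * (|(prFA κ Φ t p D g f).A| * (|(prFA κ Φ t p D g f).vβ| * sα + |(prFA κ Φ t p D g f).vα| * sβ)) / (prFA κ Φ t p D g f).D + 1

/-- **The fine extent on axis `1`**: `kFootA₁ := ⌈c₁·|A|·(|n|·sβ + |h|·sα)/D⌉` (floor + 1). [this work] -/
def kFootA₁ : ℤ := (prFA κ Φ t p D g f).c₁ * (|(prFA κ Φ t p D g f).A| * (|(prFA κ Φ t p D g f).n| * sβ + |(prFA κ Φ t p D g f).h| * sα)) / (prFA κ Φ t p D g f).D + 1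

/-- **`hL0`** at `k₀ := kFootA₀`. [folklore] -/
theorem hL0_RA (hN : EqNumL κ Φ t p D g f) :
    (prFA κ Φ t p D g f).c₀ * (|(prFA κ Φ t p D g f).A| * (|(prFA κ Φ t p D g f).vβ| * sα + |(prFA κ Φ t p D g f).vα| * sβ)) ≤ kFootA₀ κ Φ t p D g f sα sβ * (prFA κ Φ t p D g f).D := by
  have hD := (prFA_pos κ Φ t p D g f hN).2.2.2.2.2
  unfold kFootA₀; rw [mul_comm _ (prFA κ Φ t p D g f).D]; exact ceil_mul_le hD

/-- **`hL1`** at `k₁ := kFootA₁`. [folklore] -/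
theorem hL1_RA (hN : EqNumL κ Φ t p D g f) :
    (prFA κ Φ t p D g f).c₁ * (|(prFA κ Φ t p D g f).A| * (|(prFA κ Φ t p D g f).n| * sβ + |(prFA κ Φ t p D g f).h| * sα)) ≤ kFootA₁ κ Φ t p D g f sα sβ * (prFA κ Φ t p D g f).D := by
  have hD := (prFA_pos κ Φ t p D g f hN).2.2.2.2.2
  unfold kFootA₁; rw [mul_comm _ (prFA κ Φ t p D g f).D]; exact ceil_mul_le hD

/-- `0 ≤ kFootA₀`, `0 ≤ kFootA₁` for nonnegative extents (under the numeric long clause). [folklore] -/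
theorem kFootA_nonneg (hN : EqNumL κ Φ t p D g f) (hα : 0 ≤ sα) (hβ : 0 ≤ sβ) : 0 ≤ kFootA₀ κ Φ t p D g f sα sβ ∧ 0 ≤ kFootA₁ κ Φ t p D g f sα sβ := by
  obtain ⟨-, -, -, hc₀, hc₁, hD⟩ := prFA_pos κ Φ t p D g f hN
  constructor
  · unfold kFootA₀
    have : 0 ≤ (prFA κ Φ t p D g f).c₀ * (|(prFA κ Φ t p D g f).A| * (|(prFA κ Φ t p D g f).vβ| * sα + |(prFA κ Φ t p D g f).vα| * sβ)) / (prFA κ Φ t p D g f).D :=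
      Int.ediv_nonneg (by positivity) hD.le
    linarith
  · unfold kFootA₁
    have : 0 ≤ (prFA κ Φ t p D g f).c₁ * (|(prFA κ Φ t p D g f).A| * (|(prFA κ Φ t p D g f).n| * sβ + |(prFA κ Φ t p D g f).h| * sα)) / (prFA κ Φ t p D g f).D :=
      Int.ediv_nonneg (by positivity) hD.le
    linarith

/-- **THE PACKAGED READING** (map slot `φ′`): a vertex within planar extents `(sα, sβ)` of the base vertex `t` has fine position within `(kFootA₀, kFootA₁)`. [folklore] -/
theorem abs_fineA_le_of_near₂ (hN : EqNumL κ Φ t p D g f) {φ' : V → Site 2} {w : V} (h0 : |φ' w 0 - φ' t 0| ≤ sα) (h1 : |φ' w 1 - φ' t 1| ≤ sβ) :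
    |fineA κ Φ t p D g f φ' w 0| ≤ kFootA₀ κ Φ t p D g f sα sβ ∧ |fineA κ Φ t p D g f φ' w 1| ≤ kFootA₁ κ Φ t p D g f sα sβ := by
  obtain ⟨-, -, -, hc₀, hc₁, hD⟩ := prFA_pos κ Φ t p D g f hN
  have hψ : fineA κ Φ t p D g f φ' = (prFA κ Φ t p D g f).ψ φ' t := (prFA_ψ κ Φ t p D g f φ').symm
  have h := Skelφ.fine_containment₂ (φ := φ') t (s₀ := (prFA κ Φ t p D g f).D / 2) (s₁ := (prFA κ Φ t p D g f).D / 2) hD hc₀.le hc₁.le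
    (hL0_RA κ Φ t p D g f sα sβ hN) (hL1_RA κ Φ t p D g f sα sβ hN) h0 h1
  have h0' := fineA_base_at κ Φ t p D g f φ' hN
  rw [hψ] at h0' ⊢
  unfold Skelφ.FinePrm.ψ at h h0' ⊢
  rw [h0'] at h
  simpa using h

end Values

end NegB

end PlanarSkeletonNeg

end Summit.CriticalPhenomena.PercolationContinuityZ3.Theorems.Transplant

end
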